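import Summits.RiemannHypothesis.RiemannHypothesis.Theorems.JensenPolynomialsSkewFarNormalized

/-!
# Route `JensenPolynomials`, FAR crux `XiCumulantSkew98Far` — part 5: the delta method for `U = u⁻²`
(RH-FREE; cell rh-jensen, HUMAN RULING D-0040)

For `s ≥ 4·10¹⁸`, `a = a_s`, `y = (u − a)/a`, `D = u⁻² − a⁻²`, the EXACT identities
`D − a⁻²(−2y + 3y² − 4y³) = (5y⁴ + 4y⁵)/u²`, `D² − 4y²/a⁴ = −y³(12 + 23y + 16y² + 4y³)/u⁴`,
`D³ − (−8y³ + 36y⁴)/a⁶ = −y⁵(102 + 381y + 600y² + 492y³ + 208y⁴ + 36y⁵)/u⁶` turn the moments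
`J_k = E_s[D^k]` (i.e. `M_{s−2}, M_{s−4}, M_{s−6}` over `M_s`) into the Stein moments `x₁, …, x₄` of parts 3–4 plus remainders
that are moments of `y` against `Φu^{s−2k}`. Off the region `u < a/2` one has `u^{−2k} ≤ (2/a)^{2k}` and AM–GM in the scale
`λ = 1/√s`; on `u < a/2` the weight `Φu^{s−2k}` is increasing (it is below the mode of `W_{s−2k}`), whence the sup trick
`∫₀^{a/2} Φu^{s−2k} ≤ (a/2)^{1−2k}(4/a)⁷ I₆` (`leftRegion_le`). Outputs: `J1_bound`, `J2_bound`, `J3_bound`.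
WHAT THIS IS NOT: nothing here bears on the zeros of `ζ`. References: delta method (folklore); [CoffeyCsordas2013]; [GORZPNAS2019].
-/

noncomputable section
-- D-0017: `Summit.RiemannHypothesis.RiemannHypothesis.…` duplicates the namespace BY DESIGN (single-problem summit).
set_option linter.dupNamespace false

namespace Summit.RiemannHypothesis.RiemannHypothesis.Theorems.JensenPolynomials.SkewFar

open Literature.NumberTheory.LFunctions Literature.Probability.Distributions MeasureTheory Set Filter Real
open scoped Topology Nat

/-! ## 1. The exact algebra of `D = u⁻² − a⁻²` in `y = (u − a)/a` -/

/-- `D − a⁻²(−2y + 3y² − 4y³) = (5y⁴ + 4y⁵)/u²`. -/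
theorem delta_id_one {a u : ℝ} (ha : a ≠ 0) (hu : u ≠ 0) :
    1 / u ^ 2 - 1 / a ^ 2 - (-2 * ((u - a) / a) + 3 * ((u - a) / a) ^ 2 - 4 * ((u - a) / a) ^ 3) / a ^ 2 =
      (5 * ((u - a) / a) ^ 4 + 4 * ((u - a) / a) ^ 5) / u ^ 2 := by
  field_simp
  ring

/-- `D² − 4y²/a⁴ = −y³(12 + 23y + 16y² + 4y³)/u⁴`. -/
theorem delta_id_two {a u : ℝ} (ha : a ≠ 0) (hu : u ≠ 0) :
    (1 / u ^ 2 - 1 / a ^ 2) ^ 2 - 4 * ((u - a) / a) ^ 2 / a ^ 4 =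
      -((u - a) / a) ^ 3 * (12 + 23 * ((u - a) / a) + 16 * ((u - a) / a) ^ 2 + 4 * ((u - a) / a) ^ 3) / u ^ 4 := by
  field_simp
  ring

/-- `D³ − (−8y³ + 36y⁴)/a⁶ = −y⁵(102 + 381y + 600y² + 492y³ + 208y⁴ + 36y⁵)/u⁶`. -/
theorem delta_id_three {a u : ℝ} (ha : a ≠ 0) (hu : u ≠ 0) :
    (1 / u ^ 2 - 1 / a ^ 2) ^ 3 - (-8 * ((u - a) / a) ^ 3 + 36 * ((u - a) / a) ^ 4) / a ^ 6 =
      -((u - a) / a) ^ 5 * (102 + 381 * ((u - a) / a) + 600 * ((u - a) / a) ^ 2 + 492 * ((u - a) / a) ^ 3 +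
        208 * ((u - a) / a) ^ 4 + 36 * ((u - a) / a) ^ 5) / u ^ 6 := by
  field_simp
  ring

/-! ## 2. The region `u < a/2`: monotonicity and the sup trick -/
set_option maxHeartbeats 400000 in -- buildfix (bf3-g31): 160k/180k FAIL, 200k PASS at accept time; line-neutral budget line
/-- `a/2` lies below the mode of every tilt `s − j`, `j ≤ 6`: `a/2 ≤ a_{s−j}` (certified bracket `le_xiMode_of_mul_le`:
`(a/2)(4πe^{2a} − 9) ≤ 2πa e^{2a} ≤ s − 6` since `(2πa e^{2a})² = πa²A ≤ 1.0001·π a s ≤ (s−6)²`, `a ≤ s/10¹²`). -/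
theorem half_le_xiMode_sub (s : ℕ) (hs : 4 * 10 ^ 18 ≤ s) (j : ℕ) (hj : j ≤ 6) :
    xiMode (s : ℝ) / 2 ≤ xiMode (((s - j : ℕ)) : ℝ) := by
  obtain ⟨ha0, ha, _, _⟩ := mode_facts s hs
  obtain ⟨_, _, hAsa, _⟩ := consts_facts s hs (A := 4 * π * exp (4 * xiMode (s : ℝ))) (R := _) (c := _) rfl rfl rfl
  set a := xiMode (s : ℝ) with ha_def
  have hs' : (4 * 10 ^ 18 : ℝ) ≤ (s : ℝ) := by exact_mod_cast hs
  have hspos : (0 : ℝ) < s := by linarith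
  have hj6 : (j : ℝ) ≤ 6 := by exact_mod_cast hj
  have hjs : j ≤ s := le_trans hj (le_trans (by norm_num) hs)
  have hcast : (((s - j : ℕ)) : ℝ) = (s : ℝ) - j := by push_cast [Nat.cast_sub hjs]; ring
  have hs'' : (0 : ℝ) < (s : ℝ) - j := by linarith
  rw [hcast]
  refine le_xiMode_of_mul_le hs'' (by positivity) ?_
  -- `(a/2)(4πe^{2a} − 9) ≤ 2πa e^{2a}` and `(2πa e^{2a})² ≤ (s − j)²`
  have h6 := pow_six_le s hs
  have ha1 : a ≤ (s : ℝ) / 10 ^ 12 := by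
    rw [le_div_iff₀ (by norm_num)]
    have : a ≤ a ^ 6 := by
      calc a = a ^ 1 := (pow_one a).symm
        _ ≤ a ^ 6 := pow_le_pow_right₀ (by linarith) (by norm_num)
    nlinarith
  have hexp : exp (4 * (a / 2)) ^ 2 = exp (4 * a) := by rw [← Real.exp_nat_mul]; ring_nf
  have hsq : (2 * π * a * exp (4 * (a / 2))) ^ 2 ≤ ((s : ℝ) - j) ^ 2 := by
    have e : (2 * π * a * exp (4 * (a / 2))) ^ 2 = π * a ^ 2 * (4 * π * exp (4 * a)) := by rw [← hexp]; ring
    rw [e]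
    have h1 : π * a ^ 2 * (4 * π * exp (4 * a)) ≤ π * a ^ 2 * (1.0001 * ((s : ℝ) / a)) :=
      mul_le_mul_of_nonneg_left hAsa (by positivity)
    have e2 : π * a ^ 2 * (1.0001 * ((s : ℝ) / a)) = 1.0001 * π * (a * s) := by
      field_simp
    rw [e2] at h1
    have hπ := Real.pi_lt_d2
    have has : a * (s : ℝ) ≤ (s : ℝ) / 10 ^ 12 * s := mul_le_mul_of_nonneg_right ha1 hspos.le
    have h2 : 1.0001 * π * (a * s) ≤ 3.2 * ((s : ℝ) / 10 ^ 12 * s) := by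
      have : 0 ≤ a * (s : ℝ) := by positivity
      nlinarith
    have h3 : ((s : ℝ) - 6) ^ 2 ≤ ((s : ℝ) - j) ^ 2 := by
      apply pow_le_pow_left₀ (by linarith) (by linarith)
    nlinarith
  have hle : 2 * π * a * exp (4 * (a / 2)) ≤ (s : ℝ) - j := by
    have h0 : 0 ≤ 2 * π * a * exp (4 * (a / 2)) := by positivity
    nlinarith [hsq, h0]
  have : a / 2 * (4 * π * exp (4 * (a / 2)) - 9) ≤ 2 * π * a * exp (4 * (a / 2)) := by nlinarith [exp_pos (4 * (a / 2))]
  linarith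

/-- On `(0, a/2)` the weight `Φ(u)u^{s−j}` (`j ≤ 6`) is at most its value at `a/2` (it increases below the mode of `W_{s−j}`). -/
theorem weight_le_at_half (s : ℕ) (hs : 4 * 10 ^ 18 ≤ s) (j : ℕ) (hj : j ≤ 6) {u : ℝ}
    (hu : u ∈ Ioo 0 (xiMode (s : ℝ) / 2)) :
    deBruijnPhi u * u ^ (s - j) ≤ deBruijnPhi (xiMode (s : ℝ) / 2) * (xiMode (s : ℝ) / 2) ^ (s - j) := by
  obtain ⟨ha0, _, _, _⟩ := mode_facts s hs
  have hb := half_le_xiMode_sub s hs j hj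
  have hjs : j ≤ s := le_trans hj (le_trans (by norm_num) hs)
  have hs'' : (0 : ℝ) < (((s - j : ℕ)) : ℝ) := by
    have : 1 ≤ s - j := by omega
    exact_mod_cast this
  have hmono := strictAntiOn_xiPotential hs''
  have hb0 : 0 < xiMode (s : ℝ) / 2 := by positivity
  have h1 : xiPotential ((s - j : ℕ) : ℝ) (xiMode (s : ℝ) / 2) ≤ xiPotential ((s - j : ℕ) : ℝ) u :=
    (hmono.antitoneOn ⟨hu.1, le_trans hu.2.le hb⟩ ⟨hb0, hb⟩ hu.2.le)
  have e1 := exp_neg_xiPotential_natCast (s - j) hu.1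
  have e2 := exp_neg_xiPotential_natCast (s - j) hb0
  rw [mul_comm (deBruijnPhi u), mul_comm (deBruijnPhi _), ← e1, ← e2]
  exact Real.exp_le_exp.2 (by linarith)

/-- **Mass below `a/2` by the sup trick**: `Φ(a/2)(a/2)^s ≤ (4/a)⁷·I₆`
(`Φu^s ≥ Φ(a/2)(a/2)^s` on `[a/2, 3a/4]`, where `(4(a−u)/a)⁶ ≥ 1`). -/
theorem weight_at_half_le (s : ℕ) (hs : 4 * 10 ^ 18 ≤ s) :
    deBruijnPhi (xiMode (s : ℝ) / 2) * (xiMode (s : ℝ) / 2) ^ s ≤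
      (4 / xiMode (s : ℝ)) ^ 7 * xiAbsMoment s 6 (xiMode (s : ℝ)) := by
  obtain ⟨ha0, _, _, _⟩ := mode_facts s hs
  set a := xiMode (s : ℝ) with ha_def
  have hs' : (4 * 10 ^ 18 : ℝ) ≤ (s : ℝ) := by exact_mod_cast hs
  have hspos : (0 : ℝ) < s := by linarith
  have hmono := strictAntiOn_xiPotential hspos
  rw [← ha_def] at hmono
  have hb0 : 0 < a / 2 := by positivity
  -- pointwise on `[a/2, 3a/4]`
  have hpt : ∀ u ∈ Icc (a / 2) (3 * a / 4),
      deBruijnPhi (a / 2) * (a / 2) ^ s ≤ (4 / a) ^ 6 * (deBruijnPhi u * u ^ s * (u - a) ^ 6) := by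
    intro u hu
    have hu0 : 0 < u := lt_of_lt_of_le hb0 hu.1
    have h1 : xiPotential (s : ℝ) u ≤ xiPotential (s : ℝ) (a / 2) :=
      hmono.antitoneOn ⟨hb0, by linarith [hu.2]⟩ ⟨hu0, by linarith [hu.2]⟩ hu.1
    have e1 := exp_neg_xiPotential_natCast s hu0
    have e2 := exp_neg_xiPotential_natCast s hb0
    have h2 : deBruijnPhi (a / 2) * (a / 2) ^ s ≤ deBruijnPhi u * u ^ s := by
      rw [mul_comm (deBruijnPhi u), mul_comm (deBruijnPhi _), ← e1, ← e2]
      exact Real.exp_le_exp.2 (by linarith)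
    have h3 : 1 ≤ (4 / a) ^ 6 * (u - a) ^ 6 := by
      rw [← mul_pow]
      have hw : 4 / a * (u - a) ≤ -1 := by
        rw [div_mul_eq_mul_div, div_le_iff₀ ha0]; linarith [hu.2]
      have hw2 : 1 ≤ (4 / a * (u - a)) ^ 2 := by nlinarith
      calc (1 : ℝ) ≤ ((4 / a * (u - a)) ^ 2) ^ 3 := one_le_pow₀ hw2
        _ = (4 / a * (u - a)) ^ 6 := by ring
    have hw : 0 ≤ deBruijnPhi u * u ^ s := (mul_pos (deBruijnPhi_pos_holds u) (pow_pos hu0 s)).le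
    calc deBruijnPhi (a / 2) * (a / 2) ^ s ≤ deBruijnPhi u * u ^ s * 1 := by rw [mul_one]; exact h2
      _ ≤ deBruijnPhi u * u ^ s * ((4 / a) ^ 6 * (u - a) ^ 6) := mul_le_mul_of_nonneg_left h3 hw
      _ = (4 / a) ^ 6 * (deBruijnPhi u * u ^ s * (u - a) ^ 6) := by ring
  have hI := integrableOn_deBruijnPhi_mul_pow_mul_sub_pow s 6 a
  have hvol : volume.real (Icc (a / 2) (3 * a / 4)) = a / 4 := by
    rw [Real.volume_real_Icc_of_le (by linarith)]; ring
  have e6 : xiAbsMoment s 6 a = ∫ u in Ioi 0, deBruijnPhi u * u ^ s * (u - a) ^ 6 := by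
    simpa using xiAbsMoment_even s 3 a
  have hsub : Icc (a / 2) (3 * a / 4) ⊆ Ioi 0 := fun u hu => lt_of_lt_of_le hb0 hu.1
  have hI2 : IntegrableOn (fun u => (4 / a) ^ 6 * (deBruijnPhi u * u ^ s * (u - a) ^ 6)) (Icc (a / 2) (3 * a / 4)) :=
    (hI.mono_set hsub).const_mul _
  have hint : a / 4 * (deBruijnPhi (a / 2) * (a / 2) ^ s) ≤ (4 / a) ^ 6 * xiAbsMoment s 6 a := by
    rw [e6]
    calc a / 4 * (deBruijnPhi (a / 2) * (a / 2) ^ s)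
        = ∫ _ in Icc (a / 2) (3 * a / 4), deBruijnPhi (a / 2) * (a / 2) ^ s := by
          rw [setIntegral_const, hvol, smul_eq_mul]
      _ ≤ ∫ u in Icc (a / 2) (3 * a / 4), (4 / a) ^ 6 * (deBruijnPhi u * u ^ s * (u - a) ^ 6) :=
          setIntegral_mono_on (integrableOn_const (by rw [Real.volume_Icc]; exact ENNReal.ofReal_ne_top))
            hI2 measurableSet_Icc hpt
      _ ≤ ∫ u in Ioi 0, (4 / a) ^ 6 * (deBruijnPhi u * u ^ s * (u - a) ^ 6) := by
          refine setIntegral_mono_set (hI.const_mul _) ?_ (Eventually.of_forall hsub)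
          exact (ae_restrict_iff' measurableSet_Ioi).2 (ae_of_all _ fun u hu =>
            mul_nonneg (by positivity) (mul_nonneg (mul_pos (deBruijnPhi_pos_holds u) (pow_pos hu s)).le
              (Even.pow_nonneg (by decide) _)))
      _ = (4 / a) ^ 6 * ∫ u in Ioi 0, deBruijnPhi u * u ^ s * (u - a) ^ 6 := integral_const_mul _ _
  have e : (4 / a) ^ 7 * xiAbsMoment s 6 a = 4 / a * ((4 / a) ^ 6 * xiAbsMoment s 6 a) := by ring
  rw [e, mul_comm (4 / a), ← div_le_iff₀ (by positivity)]
  calc deBruijnPhi (a / 2) * (a / 2) ^ s / (4 / a) = a / 4 * (deBruijnPhi (a / 2) * (a / 2) ^ s) := by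
        field_simp
    _ ≤ _ := hint

/-- **The left region**: `∫₀^{a/2} Φu^{s−j} ≤ (a/2)·(a/2)^{s−j}Φ(a/2)` and hence `≤ (a/2)/(a/2)^j · (4/a)⁷ I₆` (`j ≤ 6`). -/
theorem leftRegion_le (s : ℕ) (hs : 4 * 10 ^ 18 ≤ s) (j : ℕ) (hj : j ≤ 6) :
    ∫ u in Ioo 0 (xiMode (s : ℝ) / 2), deBruijnPhi u * u ^ (s - j) ≤
      (xiMode (s : ℝ) / 2) / (xiMode (s : ℝ) / 2) ^ j * ((4 / xiMode (s : ℝ)) ^ 7 * xiAbsMoment s 6 (xiMode (s : ℝ))) := by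
  obtain ⟨ha0, _, _, _⟩ := mode_facts s hs
  set a := xiMode (s : ℝ) with ha_def
  have hb0 : 0 < a / 2 := by positivity
  have hjs : j ≤ s := le_trans hj (le_trans (by norm_num) hs)
  have hI : IntegrableOn (fun u => deBruijnPhi u * u ^ (s - j)) (Ioo 0 (a / 2)) :=
    (integrableOn_deBruijnPhi_mul_pow (s - j)).mono_set Ioo_subset_Ioi_self
  have hvol : volume.real (Ioo 0 (a / 2)) = a / 2 := by rw [Real.volume_real_Ioo_of_le hb0.le]; ring
  have h1 : ∫ u in Ioo 0 (a / 2), deBruijnPhi u * u ^ (s - j) ≤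
      ∫ _ in Ioo 0 (a / 2), deBruijnPhi (a / 2) * (a / 2) ^ (s - j) :=
    setIntegral_mono_on hI (integrableOn_const (by rw [Real.volume_Ioo]; exact ENNReal.ofReal_ne_top))
      measurableSet_Ioo fun u hu => weight_le_at_half s hs j hj hu
  rw [setIntegral_const, hvol, smul_eq_mul] at h1
  have h2 := weight_at_half_le s hs
  rw [← ha_def] at h2
  have hpow : (a / 2) ^ (s - j) = (a / 2) ^ s / (a / 2) ^ j := by
    rw [eq_div_iff (by positivity), ← pow_add, Nat.sub_add_cancel hjs]
  calc ∫ u in Ioo 0 (a / 2), deBruijnPhi u * u ^ (s - j) ≤ a / 2 * (deBruijnPhi (a / 2) * (a / 2) ^ (s - j)) := h1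
    _ = (a / 2) / (a / 2) ^ j * (deBruijnPhi (a / 2) * (a / 2) ^ s) := by rw [hpow]; field_simp
    _ ≤ (a / 2) / (a / 2) ^ j * ((4 / a) ^ 7 * xiAbsMoment s 6 a) := mul_le_mul_of_nonneg_left h2 (by positivity)

/-! ## 3. Generic remainder bound: polynomial majorant off `u < a/2`, sup trick on `u < a/2` -/

/-- **Generic remainder integral.** If `|r(u)| ≤ α₀ + α₁t² + ⋯ + α₅t¹⁰` for `u ≥ a/2` (`t = u − a`, all `αᵢ ≥ 0`) and
`|r(u)| ≤ B` on `(0, a/2)`, then `|∫ Φu^{s−j} r| ≤ (2/a)^j(α₀Z + α₁I₂ + ⋯ + α₅I₁₀) + B·∫₀^{a/2}Φu^{s−j}` (`j ≤ s`). -/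
theorem remainder_integral_le (s : ℕ) (hs : 4 * 10 ^ 18 ≤ s) (j : ℕ) (hj : j ≤ 6) {r : ℝ → ℝ}
    {α₀ α₁ α₂ α₃ α₄ α₅ B : ℝ} (h0 : 0 ≤ α₀) (h1 : 0 ≤ α₁) (h2 : 0 ≤ α₂) (h3 : 0 ≤ α₃) (h4 : 0 ≤ α₄) (h5 : 0 ≤ α₅)
    (hmaj : ∀ u : ℝ, xiMode (s : ℝ) / 2 ≤ u → |r u| ≤ α₀ + α₁ * (u - xiMode (s : ℝ)) ^ 2 +
      α₂ * (u - xiMode (s : ℝ)) ^ 4 + α₃ * (u - xiMode (s : ℝ)) ^ 6 + α₄ * (u - xiMode (s : ℝ)) ^ 8 +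
      α₅ * (u - xiMode (s : ℝ)) ^ 10)
    (hsup : ∀ u ∈ Ioo 0 (xiMode (s : ℝ) / 2), |r u| ≤ B) :
    |∫ u in Ioi 0, deBruijnPhi u * u ^ (s - j) * r u| ≤
      (2 / xiMode (s : ℝ)) ^ j * (α₀ * xiMoment s + α₁ * xiAbsMoment s 2 (xiMode (s : ℝ)) +
        α₂ * xiAbsMoment s 4 (xiMode (s : ℝ)) + α₃ * xiAbsMoment s 6 (xiMode (s : ℝ)) +
        α₄ * xiAbsMoment s 8 (xiMode (s : ℝ)) + α₅ * xiAbsMoment s 10 (xiMode (s : ℝ))) +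
      B * ∫ u in Ioo 0 (xiMode (s : ℝ) / 2), deBruijnPhi u * u ^ (s - j) := by
  obtain ⟨ha0, _, _, _⟩ := mode_facts s hs
  set a := xiMode (s : ℝ) with ha_def
  have hb0 : 0 < a / 2 := by positivity
  have hjs : j ≤ s := le_trans hj (le_trans (by norm_num) hs)
  have hI := fun n => integrableOn_deBruijnPhi_mul_pow_mul_sub_pow s n a
  set P : ℝ → ℝ := fun u => α₀ + α₁ * (u - a) ^ 2 + α₂ * (u - a) ^ 4 + α₃ * (u - a) ^ 6 + α₄ * (u - a) ^ 8 +
    α₅ * (u - a) ^ 10 with hP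
  have hP0 : ∀ u, 0 ≤ P u := fun u => by
    simp only [hP]
    have e2 : 0 ≤ (u - a) ^ 2 := by positivity
    have e4 : 0 ≤ (u - a) ^ 4 := by positivity
    have e6 : 0 ≤ (u - a) ^ 6 := by positivity
    have e8 : 0 ≤ (u - a) ^ 8 := by positivity
    have e10 : 0 ≤ (u - a) ^ 10 := by positivity
    positivity
  -- the dominating function
  set g : ℝ → ℝ := fun u => deBruijnPhi u * u ^ s * ((2 / a) ^ j * P u) +
    B * (Ioo 0 (a / 2)).indicator (fun u => deBruijnPhi u * u ^ (s - j)) u with hg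
  have hgP : IntegrableOn (fun u => deBruijnPhi u * u ^ s * ((2 / a) ^ j * P u)) (Ioi 0) := by
    have h := (((((((hI 0).const_mul α₀).add ((hI 2).const_mul α₁)).add ((hI 4).const_mul α₂)).add
      ((hI 6).const_mul α₃)).add ((hI 8).const_mul α₄)).add ((hI 10).const_mul α₅)).const_mul ((2 / a) ^ j)
    refine IntegrableOn.congr_fun h (fun u _ => ?_) measurableSet_Ioi
    simp only [Pi.add_apply, pow_zero, mul_one, hP]
    ring
  have hgI : IntegrableOn (fun u => B * (Ioo 0 (a / 2)).indicator (fun u => deBruijnPhi u * u ^ (s - j)) u) (Ioi 0) :=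
    (((integrableOn_deBruijnPhi_mul_pow (s - j)).indicator measurableSet_Ioo)).const_mul B
  have hgint : IntegrableOn g (Ioi 0) := hgP.add hgI
  -- pointwise domination
  have hdom : ∀ u ∈ Ioi (0 : ℝ), ‖deBruijnPhi u * u ^ (s - j) * r u‖ ≤ g u := by
    intro u (hu : 0 < u)
    have hw : 0 < deBruijnPhi u * u ^ (s - j) := mul_pos (deBruijnPhi_pos_holds u) (pow_pos hu _)
    have hws : 0 ≤ deBruijnPhi u * u ^ s := (mul_pos (deBruijnPhi_pos_holds u) (pow_pos hu s)).le
    rw [Real.norm_eq_abs, abs_mul, abs_of_pos hw, hg]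
    simp only
    by_cases hua : a / 2 ≤ u
    · -- off the left region: `u^{s-j} ≤ u^s (2/a)^j`
      have hind : (Ioo 0 (a / 2)).indicator (fun u => deBruijnPhi u * u ^ (s - j)) u = 0 :=
        Set.indicator_of_notMem (fun h => (not_lt.2 hua) h.2) _
      rw [hind, mul_zero, add_zero]
      have hpow : u ^ (s - j) ≤ u ^ s * (2 / a) ^ j := by
        have h1 : u ^ s = u ^ (s - j) * u ^ j := by rw [← pow_add, Nat.sub_add_cancel hjs]
        have h2 : 1 ≤ u ^ j * (2 / a) ^ j := by
          rw [← mul_pow]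
          exact one_le_pow₀ (by rw [mul_div_assoc', le_div_iff₀ ha0]; linarith)
        calc u ^ (s - j) = u ^ (s - j) * 1 := (mul_one _).symm
          _ ≤ u ^ (s - j) * (u ^ j * (2 / a) ^ j) := mul_le_mul_of_nonneg_left h2 (pow_pos hu _).le
          _ = u ^ s * (2 / a) ^ j := by rw [h1]; ring
      calc deBruijnPhi u * u ^ (s - j) * |r u| ≤ deBruijnPhi u * u ^ (s - j) * P u :=
            mul_le_mul_of_nonneg_left (hmaj u hua) hw.le
        _ ≤ deBruijnPhi u * (u ^ s * (2 / a) ^ j) * P u := by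
            apply mul_le_mul_of_nonneg_right _ (hP0 u)
            exact mul_le_mul_of_nonneg_left hpow (deBruijnPhi_pos_holds u).le
        _ = deBruijnPhi u * u ^ s * ((2 / a) ^ j * P u) := by ring
    · have hua' : u < a / 2 := not_le.1 hua
      have hmem : u ∈ Ioo 0 (a / 2) := ⟨hu, hua'⟩
      have hind : (Ioo 0 (a / 2)).indicator (fun u => deBruijnPhi u * u ^ (s - j)) u = deBruijnPhi u * u ^ (s - j) :=
        Set.indicator_of_mem hmem _
      rw [hind]
      have hpoly : 0 ≤ deBruijnPhi u * u ^ s * ((2 / a) ^ j * P u) := mul_nonneg hws (mul_nonneg (by positivity) (hP0 u))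
      calc deBruijnPhi u * u ^ (s - j) * |r u| ≤ deBruijnPhi u * u ^ (s - j) * B :=
            mul_le_mul_of_nonneg_left (hsup u hmem) hw.le
        _ = B * (deBruijnPhi u * u ^ (s - j)) := by ring
        _ ≤ _ := by linarith
  have key := norm_integral_le_of_norm_le (μ := volume.restrict (Ioi (0 : ℝ))) hgint
    ((ae_restrict_iff' measurableSet_Ioi).2 (ae_of_all _ hdom))
  rw [Real.norm_eq_abs] at key
  refine key.trans (le_of_eq ?_)
  simp only [hg]
  rw [integral_add hgP hgI, integral_const_mul, setIntegral_indicator measurableSet_Ioo,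
    show Ioi (0 : ℝ) ∩ Ioo 0 (a / 2) = Ioo 0 (a / 2) from
      Set.inter_eq_self_of_subset_right Ioo_subset_Ioi_self]
  have e : ∫ u in Ioi 0, deBruijnPhi u * u ^ s * ((2 / a) ^ j * P u) =
      (2 / a) ^ j * ∫ u in Ioi 0, deBruijnPhi u * u ^ s * P u := by
    rw [← integral_const_mul]
    refine setIntegral_congr_fun measurableSet_Ioi fun u _ => ?_
    ring
  rw [e, hP, integral_evenPoly]

/-! ## 4. The three delta-method bounds -/

/-- AM–GM in the `y`-scale: `p·|y| ≤ (λ p + p y²/λ)/2` for `p ≥ 0`, `λ > 0` (restated for readability). -/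
theorem amgm_y {lam p y : ℝ} (hl : 0 < lam) (hp : 0 ≤ p) : p * |y| ≤ (lam * p + p * y ^ 2 / lam) / 2 :=
  mul_abs_le hl y hp

/-- **J₁.** `|M_{s−2} − M_s/a² − (−2I₁/a + 3I₂/a² − 4I₃/a³)/a²| ≤ (2/a)²((5+2λ)I₄/a⁴ + (2/λ)I₆/a⁶) + 9·(a/2)/(a/2)²·(4/a)⁷I₆`. -/
theorem J1_bound (s : ℕ) (hs : 4 * 10 ^ 18 ≤ s) {lam : ℝ} (hl : 0 < lam) :
    |xiMoment (s - 2) - xiMoment s / xiMode (s : ℝ) ^ 2 -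
        (-2 * (∫ u in Ioi 0, deBruijnPhi u * u ^ s * (u - xiMode (s : ℝ))) / xiMode (s : ℝ) +
          3 * xiAbsMoment s 2 (xiMode (s : ℝ)) / xiMode (s : ℝ) ^ 2 -
          4 * (∫ u in Ioi 0, deBruijnPhi u * u ^ s * (u - xiMode (s : ℝ)) ^ 3) / xiMode (s : ℝ) ^ 3) / xiMode (s : ℝ) ^ 2| ≤
      (2 / xiMode (s : ℝ)) ^ 2 * ((5 + 2 * lam) / xiMode (s : ℝ) ^ 4 * xiAbsMoment s 4 (xiMode (s : ℝ)) +
        2 / (lam * xiMode (s : ℝ) ^ 6) * xiAbsMoment s 6 (xiMode (s : ℝ))) +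
      9 * ((xiMode (s : ℝ) / 2) / (xiMode (s : ℝ) / 2) ^ 2 * ((4 / xiMode (s : ℝ)) ^ 7 * xiAbsMoment s 6 (xiMode (s : ℝ)))) := by
  obtain ⟨ha0, _, _, _⟩ := mode_facts s hs
  set a := xiMode (s : ℝ) with ha_def
  have hs2 : 2 ≤ s := le_trans (by norm_num) hs
  have hI := fun n => integrableOn_deBruijnPhi_mul_pow_mul_sub_pow s n a
  set r : ℝ → ℝ := fun u => 5 * ((u - a) / a) ^ 4 + 4 * ((u - a) / a) ^ 5 with hr
  -- the identity
  have hid : xiMoment (s - 2) - xiMoment s / a ^ 2 -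
      (-2 * (∫ u in Ioi 0, deBruijnPhi u * u ^ s * (u - a)) / a + 3 * xiAbsMoment s 2 a / a ^ 2 -
        4 * (∫ u in Ioi 0, deBruijnPhi u * u ^ s * (u - a) ^ 3) / a ^ 3) / a ^ 2 =
      ∫ u in Ioi 0, deBruijnPhi u * u ^ (s - 2) * r u := by
    have e2 : xiAbsMoment s 2 a = ∫ u in Ioi 0, deBruijnPhi u * u ^ s * (u - a) ^ 2 := by
      simpa using xiAbsMoment_even s 1 a
    have e1 : (∫ u in Ioi 0, deBruijnPhi u * u ^ s * (u - a)) = ∫ u in Ioi 0, deBruijnPhi u * u ^ s * (u - a) ^ 1 := by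
      simp
    rw [e2, e1, xiMoment, xiMoment]
    have hpt : ∀ u ∈ Ioi (0 : ℝ), deBruijnPhi u * u ^ (s - 2) * r u =
        deBruijnPhi u * u ^ (s - 2) - (1 / a ^ 2) * (deBruijnPhi u * u ^ s) -
        ((-2 / a ^ 3) * (deBruijnPhi u * u ^ s * (u - a) ^ 1) + (3 / a ^ 4) * (deBruijnPhi u * u ^ s * (u - a) ^ 2) +
          (-4 / a ^ 5) * (deBruijnPhi u * u ^ s * (u - a) ^ 3)) := by
      intro u (hu : 0 < u)
      have hid := delta_id_one ha0.ne' hu.ne'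
      have hus : u ^ s = u ^ (s - 2) * u ^ 2 := by rw [← pow_add, Nat.sub_add_cancel hs2]
      simp only [hr]
      rw [hus]
      have hu2 : u ^ 2 ≠ 0 := pow_ne_zero 2 hu.ne'
      field_simp
      field_simp at hid
      linear_combination deBruijnPhi u * u ^ (s - 2) * a * hid
    rw [setIntegral_congr_fun measurableSet_Ioi hpt, integral_sub, integral_sub, integral_add, integral_add,
      integral_const_mul, integral_const_mul, integral_const_mul, integral_const_mul]
    · field_simp
      ring
    · exact (hI 1).const_mul _
    · exact (hI 2).const_mul _
    · exact ((hI 1).const_mul _).add ((hI 2).const_mul _)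
    · exact (hI 3).const_mul _
    · exact integrableOn_deBruijnPhi_mul_pow (s - 2)
    · exact (integrableOn_deBruijnPhi_mul_pow s).const_mul _
    · exact (integrableOn_deBruijnPhi_mul_pow (s - 2)).sub ((integrableOn_deBruijnPhi_mul_pow s).const_mul _)
    · exact (((hI 1).const_mul _).add ((hI 2).const_mul _)).add ((hI 3).const_mul _)
  rw [hid]
  -- the generic bound with `α₂ = (5+2λ)/a⁴`, `α₃ = 2/(λa⁶)`, `B = 9`
  have hmaj : ∀ u : ℝ, a / 2 ≤ u → |r u| ≤ 0 + 0 * (u - a) ^ 2 + (5 + 2 * lam) / a ^ 4 * (u - a) ^ 4 +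
      2 / (lam * a ^ 6) * (u - a) ^ 6 + 0 * (u - a) ^ 8 + 0 * (u - a) ^ 10 := by
    intro u _
    simp only [hr]
    set y := (u - a) / a with hy
    have h4 : 0 ≤ y ^ 4 := by positivity
    have ham := amgm_y (y := y) hl h4
    have e : y = (u - a) * a⁻¹ := by rw [hy, div_eq_mul_inv]
    have e5 : |y ^ 5| = y ^ 4 * |y| := by
      rw [abs_pow, pow_succ, Even.pow_abs (by decide : Even 4)]
    calc |5 * y ^ 4 + 4 * y ^ 5| ≤ |5 * y ^ 4| + |4 * y ^ 5| := abs_add_le _ _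
      _ = 5 * y ^ 4 + 4 * (y ^ 4 * |y|) := by
          rw [abs_mul, abs_of_pos (by norm_num : (0:ℝ) < 5), abs_of_nonneg h4, abs_mul,
            abs_of_pos (by norm_num : (0:ℝ) < 4), e5]
      _ ≤ 5 * y ^ 4 + 4 * ((lam * y ^ 4 + y ^ 4 * y ^ 2 / lam) / 2) := by linarith
      _ = 0 + 0 * (u - a) ^ 2 + (5 + 2 * lam) / a ^ 4 * (u - a) ^ 4 + 2 / (lam * a ^ 6) * (u - a) ^ 6 +
          0 * (u - a) ^ 8 + 0 * (u - a) ^ 10 := by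
          rw [e]; field_simp; ring
  have hsup : ∀ u ∈ Ioo 0 (a / 2), |r u| ≤ 9 := by
    intro u hu
    simp only [hr]
    set y := (u - a) / a with hy
    have hy1 : |y| ≤ 1 := by
      rw [hy, abs_div, abs_of_pos ha0, div_le_one ha0, abs_le]
      constructor <;> linarith [hu.1, hu.2]
    have hy4 : |y| ^ 4 ≤ 1 := pow_le_one₀ (abs_nonneg _) hy1
    have hy5 : |y| ^ 5 ≤ 1 := pow_le_one₀ (abs_nonneg _) hy1
    calc |5 * y ^ 4 + 4 * y ^ 5| ≤ |5 * y ^ 4| + |4 * y ^ 5| := abs_add_le _ _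
      _ = 5 * |y| ^ 4 + 4 * |y| ^ 5 := by
          rw [abs_mul, abs_mul, abs_of_pos (by norm_num : (0:ℝ) < 5), abs_of_pos (by norm_num : (0:ℝ) < 4),
            abs_pow, abs_pow]
      _ ≤ 9 := by linarith
  have h := remainder_integral_le s hs 2 (by norm_num) (r := r) le_rfl le_rfl (by positivity) (by positivity) le_rfl le_rfl
    hmaj hsup
  have hL := leftRegion_le s hs 2 (by norm_num)
  rw [← ha_def] at h hL
  simp only [zero_mul, zero_add, add_zero] at h
  calc |∫ u in Ioi 0, deBruijnPhi u * u ^ (s - 2) * r u|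
      ≤ (2 / a) ^ 2 * ((5 + 2 * lam) / a ^ 4 * xiAbsMoment s 4 a + 2 / (lam * a ^ 6) * xiAbsMoment s 6 a) +
          9 * ∫ u in Ioo 0 (a / 2), deBruijnPhi u * u ^ (s - 2) := h
    _ ≤ (2 / a) ^ 2 * ((5 + 2 * lam) / a ^ 4 * xiAbsMoment s 4 a + 2 / (lam * a ^ 6) * xiAbsMoment s 6 a) +
          9 * ((a / 2) / (a / 2) ^ 2 * ((4 / a) ^ 7 * xiAbsMoment s 6 a)) := by linarith

end Summit.RiemannHypothesis.RiemannHypothesis.Theorems.JensenPolynomials.SkewFar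

end
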